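import Summits.QuantumFields.BalabanUV.Beta.RemainderExplicitHistoryDiagonalLawEverywhere

/-!
# RemainderExplicitHistoryDiagonalTransport — ROAD P3, ORDER-0 PROFILE FAMILY: THE UPPER LAW AT EVERY POSITION, UNCONDITIONAL — THE LOCAL
# MISSING AGES PLUS THE ULTRAVIOLET-END DISCREPANCY TRANSPORTED BY AN EXPLICIT FEEDBACK WEIGHT, and THE SUPERSOLUTION PRINCIPLE.
# For two pinned runs (A: `K` steps, B: `K + n` steps, `2Wγ < b`) at EVERY position `j₀ < K`:
# `d_{j₀} ≤ C_w·𝒮(j₀) + (C_w²∕(1−Wγ∕b))·𝒮(0)·Φ(j₀)`, where `𝒮(j₀) = (4κ∕(K√(b(K−j₀))))·Σ_a ρ(a)min(a,K)(min(a,K)−j₀)₊` is the first file's source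
# bound,
# `𝒮(0)` is generation 48's ultraviolet-end law, and `Φ(j₀) = (1∕(2b√b))·Σ_{i<j₀} (R(K−i) − R(j₀−i))∕((K−i)√(K−i)) ≤ Ts∕(2b√b(K−j₀)√(K−j₀))` is the
# profile's FEEDBACK WEIGHT into `j₀` (the ultraviolet positions `i < j₀` carry `d_i ≤ d_0∕(1−Wγ∕b)` by generation 50's comparison, `d_0 ≤ C_w𝒮(0)`
# since the ultraviolet end has no feedback, and they act on `j₀` through the cubes `(g^A_i)³∕2 ≤ (2b√b(K−i)^{3∕2})⁻¹` and the ages `[j₀−i, K−i)`).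
# More generally `d ≤ M` for EVERY supersolution `M` of the comparison recursion `C_w(𝒮(j₀) + Σ_{i<j₀} M(i)(R(K−i)−R(j₀−i))∕(2b√b(K−i)^{3∕2})) ≤ M(j₀)`
# (third file of station S-d4p3-g52-1 «the law at every position»; with the second file's lower law the matched discrepancy is now pinched at
# EVERY position between two explicit profile functionals; family forms for every `(m, n)` in §3)

Cell `pub-balaban`, β-function sub-cell, BINDER row D4 «RemainderConst leaves for Bałaban's split» (`HOME/BINDER-OWNERS.md`; owner lineage
`b2b-balaban-beta-an4`; this file by co-owner #3 lineage `b2b-balaban-beta-d4-p3`, road P3 «the reduction road», generation 52, station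
S-d4p3-g52-1, third file; imports the station's second file `RemainderExplicitHistoryDiagonalLawEverywhere`), β-FLOW TEAM duty (1); FREEZE (0)
honoured (def-free module in road P3's own `RemainderExplicit*` series; no leaf, no interface, no Literature file).  SOURCE OF THE SHAPES ONLY:
[Balaban1987RG1] (0.20) p. 256, (0.31) and Thm 2 p. 259, §5 p. 298.  [folklore] real analysis about ONE explicit toy family (ours), road P3's
ORDER-0 PROFILE FAMILY `β_{k+1} = b + Σ_{i≤k} ρ(k−i)·min(g_k, |g_k − g_i|)` (generation 44), memory PROFILE `ρ ≥ 0` summable (`Σ_{a<N} ρ_a ≤ W`).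
HONEST FRAMING: *"Discharging BetaPertH makes Bałaban's UV stability UNCONDITIONAL — a real constructive-QFT result; it is NOT the continuum
limit and NOT the Clay problem."*  THIS FILE DISCHARGES NOTHING OF THE KIND; nothing of Bałaban's (1.22) is asserted or constructed; row D4
class UNCHANGED (critical-path width 0; instance 0∕1; D4 DISCHARGE NO DATE); NOT B12 Thm 2, NOT BetaPertH, NOT continuum, NOT Clay.  HONEST
DEPENDENCY: continuum YM on T⁴ ⇐ BetaPertH ∧ nine spine estimates (0/9 proved); BetaPertH ⇐ (D1) ∧ (D4) ∧ CAP+tail; G-an2-4 gates asym, D1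
and NE2/3/4.  ABSOLUTE RULE: nothing is cited as a fact.  All letters NOT-IN-PRINT; `BetaFlowAsPrinted S` records a Markov β_n only.
WHY A TRANSPORT TERM IS UNAVOIDABLE: for a profile of bounded memory `A` the local source `𝒮(j₀)` vanishes at every `j₀ ≥ A` while `d_{j₀} > 0`
(pure ultraviolet feedback; `g52/numerics/everywhere_shape.out`, short flat profile) — no law `d ≲ 𝒮` can hold for all profiles.  The transported
term is below the local one wherever `𝒮(0)·Φ(j₀) ≲ 𝒮(j₀)` — e.g. power tails `q < 2` on the whole ultraviolet half (relative size `≲ Ts∕K^{3∕2}`) —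
and dominates near the pin (`K − j₀` small), where generations 49–51's infrared-half law `√(K−j₀)·τ(j₀+1)` is the sharp one.

WHAT IS PROVED ([folklore]; 0 sorry; 0 `def`; pair A: `K` steps, B: `K + n` steps in ]0,γ], pinned; `d_j`, `R(k) = Σ_{a<k} ρ(a)`, `κ = (b+Wγ)∕b`,
`C_w = (1−Wγ∕b)∕(1−2Wγ∕b)`; `𝒮`, `Φ` as displayed above, written out in full).
* §1 `feedback_le_transport` (`Σ_{i<j₀}((g^A_i)³∕2)d_i(R(K−i)−R(j₀−i)) ≤ (d_0∕(1−Wγ∕b))·Φ(j₀)`, `Wγ < b`); `disc_zero_le_source` (`d_0 ≤ C_w·𝒮(0)`, `2Wγ < b`);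
  **`disc_upper_transport`** (the title law); `feedbackWeight_le_tailSum` (`Φ(j₀) ≤ Ts∕(2b√b(K−j₀)√(K−j₀))` for `Ts ≥ Σ_{k<j₀} τ(k+1)`, `τ` a tail majorant).
* §2 **`disc_le_supersolution`** (every `M` with `C_w(𝒮(j₀) + Σ_{i<j₀} M(i)(R(K−i)−R(j₀−i))∕(2b√b(K−i)√(K−i))) ≤ M(j₀)` for all `j₀ < K` dominates `d`).
* §3 FAMILY FORM **`astar_sub_invSq_upper_transport`** (pinned family, `2Wγ < b`, every `m ≥ 1`, `n`: `astar g m − invSq g m n ≤ C_w(4κ∕((n+m)√(bm)))Ψ +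
  (C_w²∕(1−Wγ∕b))(4κ∕((n+m)√(b(n+m))))Ψ₀·Φ` for partial-sum bounds `Ψ ≥ Σ_a ρ(a)min(a,n+m)(min(a,n+m)−n)₊`, `Ψ₀ ≥ Σ_a ρ(a)min(a,n+m)²`, `Φ` at `(n; n+m)`).
-/

noncomputable section

open Finset Filter Topology

namespace Summit.QuantumFields.BalabanUV.Beta.RemainderExplicitHistoryDiagonalTransport

open Literature.MathematicalPhysics.QuantumFieldTheory.Balaban1983to89
open Literature.MathematicalPhysics.QuantumFieldTheory.Balaban1983to89.FlowStep
open Literature.MathematicalPhysics.QuantumFieldTheory.Balaban1983to89.T4CouplingMatching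
open Literature.MathematicalPhysics.QuantumFieldTheory.Balaban1983to89.T4ContinuumCoupling
open Summit.QuantumFields.BalabanUV.Beta.RemainderExplicitHistoryDiagonalMonotone
open Summit.QuantumFields.BalabanUV.Beta.RemainderExplicitHistoryDiagonalWeights
open Summit.QuantumFields.BalabanUV.Beta.RemainderExplicitHistoryDiagonalTwoRun
open Summit.QuantumFields.BalabanUV.Beta.RemainderExplicitHistoryDiagonalWindow
open Summit.QuantumFields.BalabanUV.Beta.RemainderExplicitHistoryDiagonalComparison
open Summit.QuantumFields.BalabanUV.Beta.RemainderExplicitHistoryDiagonalRate (cube_half_le)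
open Summit.QuantumFields.BalabanUV.Beta.RemainderExplicitHistoryDiagonalLawEverywhere

variable {β : HBeta} {b γ W : ℝ} {ρ : ℕ → ℝ}

/-! ## §1 The ultraviolet feedback transported from the ultraviolet end -/

/-- **THE FEEDBACK IS AT MOST THE ULTRAVIOLET-END DISCREPANCY TIMES THE PROFILE'S FEEDBACK WEIGHT** (`Wγ < b`).  Two pinned runs of the order-0
profile family in ]0,γ] (A: `K` steps, B: `K + n` steps); then for every `j₀ ≤ K`:
`Σ_{i<j₀} ((g^A_i)³∕2)·d_i·(R(K−i) − R(j₀−i)) ≤ (d_0∕(1 − Wγ∕b))·(1∕(2b√b))·Σ_{i<j₀} (R(K−i) − R(j₀−i))∕((K−i)√(K−i))` — every ultraviolet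
position
carries `d_i ≤ d_0∕(1−Wγ∕b)` (generation 50's `max_disc_le_disc_div` at the ultraviolet end) and `(g^A_i)³∕2 ≤ (2b√b(K−i)^{3∕2})⁻¹` (generation 49's
`cube_half_le`). [cite: Balaban1987RG1, (0.20) p.256, (0.31) and Thm 2 p.259] -/
theorem feedback_le_transport
    (hβ : ∀ (k : ℕ) (p : Fin (k + 1) → ℝ),
      β k p = b + ∑ i : Fin (k + 1), ρ (k - i) * min (p (Fin.last k)) (|p (Fin.last k) - p i|))
    (hb : 0 < b) (hγ : 0 < γ) (hρ0 : ∀ a, 0 ≤ ρ a) (hρW : ∀ n, ∑ a ∈ range n, ρ a ≤ W) (hsmall : W * γ < b) {K n : ℕ}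
    {gA gB : ℕ → ℝ} (hA : RGEqH K β gA) (hB : RGEqH (K + n) β gB) (hAbox : ∀ k, k ≤ K → 0 < gA k ∧ gA k ≤ γ)
    (hBbox : ∀ k, k ≤ K + n → 0 < gB k ∧ gB k ≤ γ) (hpin : gA K = gB (K + n)) {j₀ : ℕ} (hj₀ : j₀ ≤ K) :
    ∑ i ∈ range j₀, (gA i) ^ 3 / 2 * (1 / (gB (i + n)) ^ 2 - 1 / (gA i) ^ 2)
        * (∑ a ∈ range (K - i), ρ a - ∑ a ∈ range (j₀ - i), ρ a)
      ≤ (1 / (gB n) ^ 2 - 1 / (gA 0) ^ 2) / (1 - W * γ / b)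
        * (1 / (2 * b * Real.sqrt b) * ∑ i ∈ range j₀,
            (∑ a ∈ range (K - i), ρ a - ∑ a ∈ range (j₀ - i), ρ a) / (((K - i : ℕ) : ℝ) * Real.sqrt ((K - i : ℕ) : ℝ))) := by
  have hApos : ∀ k, k ≤ K → 0 < gA k := fun k hk => (hAbox k hk).1
  have hBpos : ∀ k, k ≤ K + n → 0 < gB k := fun k hk => (hBbox k hk).1
  have hlo : BetaLowerH b γ β :=
    RemainderExplicitHistoryHalfMomentWitness.lower (γ := γ) (lam := fun k i => ρ (k - i)) hβ (fun k i => hρ0 _)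
  have hmax := max_disc_le_disc_div hβ hb hγ hρ0 hρW hsmall hA hB hAbox hBpos hpin 0
  simp only [Nat.zero_add] at hmax
  have hdom := invSq_le_invSq_shift_run hβ hb hρ0 hA hB hApos hBpos hpin
  set P : ℝ := (1 / (gB n) ^ 2 - 1 / (gA 0) ^ 2) / (1 - W * γ / b) with hP
  rw [Finset.mul_sum, Finset.mul_sum]
  refine Finset.sum_le_sum fun i hi => ?_
  have hi' := Finset.mem_range.mp hi
  have hiK : i < K := lt_of_lt_of_le hi' hj₀
  have hd0 : 0 ≤ 1 / (gB (i + n)) ^ 2 - 1 / (gA i) ^ 2 := by linarith [hdom i hiK.le]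
  have hdP : 1 / (gB (i + n)) ^ 2 - 1 / (gA i) ^ 2 ≤ P := hmax i (Finset.mem_Icc.mpr ⟨Nat.zero_le i, hiK.le⟩)
  have hw0 : 0 ≤ ∑ a ∈ range (K - i), ρ a - ∑ a ∈ range (j₀ - i), ρ a := by
    linarith [partialSum_mono hρ0 (show j₀ - i ≤ K - i by omega)]
  have hc0 : 0 ≤ (gA i) ^ 3 / 2 := by have := hApos i hiK.le; positivity
  have hcube := cube_half_le hγ hb hA hAbox hlo hiK
  have hs0 : (0 : ℝ) < ((K - i : ℕ) : ℝ) := by exact_mod_cast (show 0 < K - i by omega)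
  calc (gA i) ^ 3 / 2 * (1 / (gB (i + n)) ^ 2 - 1 / (gA i) ^ 2) * (∑ a ∈ range (K - i), ρ a - ∑ a ∈ range (j₀ - i), ρ a)
      ≤ (1 / (2 * b * Real.sqrt b) * (1 / (((K - i : ℕ) : ℝ) * Real.sqrt ((K - i : ℕ) : ℝ)))) * P
          * (∑ a ∈ range (K - i), ρ a - ∑ a ∈ range (j₀ - i), ρ a) := by
        refine mul_le_mul_of_nonneg_right (mul_le_mul hcube hdP hd0 (by positivity)) hw0
    _ = P * (1 / (2 * b * Real.sqrt b) * ((∑ a ∈ range (K - i), ρ a - ∑ a ∈ range (j₀ - i), ρ a)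
          / (((K - i : ℕ) : ℝ) * Real.sqrt ((K - i : ℕ) : ℝ)))) := by
        field_simp

/-- **THE ULTRAVIOLET END HAS NO FEEDBACK: `d_0 ≤ C_w·𝒮(0)`** (`2Wγ < b`, `K ≥ 1`).  Same pinned runs with `2Wγ < b`:
`1∕(g^B_n)² − 1∕(g^A_0)² ≤ C_w·(4κ∕(K√(bK)))·Σ_{a<K+n} ρ(a)·min(a,K)²` (the second file's `disc_upper_everywhere` at `j₀ = 0`: empty feedback sum;
generation 48's law up to the constant). [cite: Balaban1987RG1, (0.20) p.256, (0.31) and Thm 2 p.259] -/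
theorem disc_zero_le_source
    (hβ : ∀ (k : ℕ) (p : Fin (k + 1) → ℝ),
      β k p = b + ∑ i : Fin (k + 1), ρ (k - i) * min (p (Fin.last k)) (|p (Fin.last k) - p i|))
    (hb : 0 < b) (hγ : 0 < γ) (hρ0 : ∀ a, 0 ≤ ρ a) (hρW : ∀ n, ∑ a ∈ range n, ρ a ≤ W) (hsmall2 : 2 * W * γ < b) {K n : ℕ}
    {gA gB : ℕ → ℝ} (hA : RGEqH K β gA) (hB : RGEqH (K + n) β gB) (hAbox : ∀ k, k ≤ K → 0 < gA k ∧ gA k ≤ γ)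
    (hBbox : ∀ k, k ≤ K + n → 0 < gB k ∧ gB k ≤ γ) (hpin : gA K = gB (K + n)) (hK : 1 ≤ K) :
    1 / (gB n) ^ 2 - 1 / (gA 0) ^ 2
      ≤ (1 - W * γ / b) / (1 - 2 * W * γ / b)
        * (4 * ((b + W * γ) / b) / ((K : ℝ) * Real.sqrt (b * (K : ℝ)))
            * ∑ a ∈ range (K + n), ρ a * (min (a : ℝ) K) ^ 2) := by
  have h := disc_upper_everywhere hβ hb hγ hρ0 hρW hsmall2 hA hB hAbox hBbox hpin (j₀ := 0) (by omega)
  simp only [Nat.zero_add, Finset.range_zero, Finset.sum_empty, add_zero, Nat.sub_zero] at h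
  have e : ∑ a ∈ range (K + n), ρ a * (min (a : ℝ) K * ((min a K : ℕ) : ℝ)) = ∑ a ∈ range (K + n), ρ a * (min (a : ℝ) K) ^ 2 := by
    refine Finset.sum_congr rfl fun a _ => ?_
    rw [Nat.cast_min, sq]
  rw [e] at h
  exact h

/-- **THE UPPER LAW AT EVERY POSITION, UNCONDITIONAL: LOCAL MISSING AGES PLUS THE TRANSPORTED ULTRAVIOLET END** (`2Wγ < b`).  Two runs of the
order-0 profile family in ]0,γ] (`b > 0`, `γ > 0`, `ρ ≥ 0`, `Σ_{a<N} ρ_a ≤ W`, `2Wγ < b`) — A: `K` steps, B: `K + n` steps — pinned; `κ = (b+Wγ)∕b`,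
`C_w = (1−Wγ∕b)∕(1−2Wγ∕b)`.  THEN at EVERY position `j₀ < K`:
`d_{j₀} ≤ C_w·(4κ∕(K√(b(K−j₀))))·Σ_{a<K+n} ρ(a)min(a,K)(min(a,K)−j₀)₊`
`        + C_w·(C_w∕(1−Wγ∕b))·((4κ∕(K√(bK)))·Σ_{a<K+n} ρ(a)min(a,K)²)·(1∕(2b√b))·Σ_{i<j₀} (R(K−i) − R(j₀−i))∕((K−i)√(K−i))` — the second file's
`disc_upper_everywhere` with its feedback priced by `feedback_le_transport` and `disc_zero_le_source`.  Sharp wherever the transported term is below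
the local one (`𝒮(0)Φ(j₀) ≲ 𝒮(j₀)`); near the pin generations 49–51's infrared-half law is the sharp one.
[cite: Balaban1987RG1, (0.20) p.256, (0.31) and Thm 2 p.259] -/
theorem disc_upper_transport
    (hβ : ∀ (k : ℕ) (p : Fin (k + 1) → ℝ),
      β k p = b + ∑ i : Fin (k + 1), ρ (k - i) * min (p (Fin.last k)) (|p (Fin.last k) - p i|))
    (hb : 0 < b) (hγ : 0 < γ) (hρ0 : ∀ a, 0 ≤ ρ a) (hρW : ∀ n, ∑ a ∈ range n, ρ a ≤ W) (hsmall2 : 2 * W * γ < b) {K n : ℕ}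
    {gA gB : ℕ → ℝ} (hA : RGEqH K β gA) (hB : RGEqH (K + n) β gB) (hAbox : ∀ k, k ≤ K → 0 < gA k ∧ gA k ≤ γ)
    (hBbox : ∀ k, k ≤ K + n → 0 < gB k ∧ gB k ≤ γ) (hpin : gA K = gB (K + n)) {j₀ : ℕ} (hj₀K : j₀ < K) :
    1 / (gB (j₀ + n)) ^ 2 - 1 / (gA j₀) ^ 2
      ≤ (1 - W * γ / b) / (1 - 2 * W * γ / b)
          * (4 * ((b + W * γ) / b) / ((K : ℝ) * Real.sqrt (b * ((K - j₀ : ℕ) : ℝ)))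
            * ∑ a ∈ range (K + n), ρ a * (min (a : ℝ) K * ((min a K - j₀ : ℕ) : ℝ)))
        + (1 - W * γ / b) / (1 - 2 * W * γ / b) * ((1 - W * γ / b) / (1 - 2 * W * γ / b) / (1 - W * γ / b))
          * (4 * ((b + W * γ) / b) / ((K : ℝ) * Real.sqrt (b * (K : ℝ))) * ∑ a ∈ range (K + n), ρ a * (min (a : ℝ) K) ^ 2)
          * (1 / (2 * b * Real.sqrt b) * ∑ i ∈ range j₀,
              (∑ a ∈ range (K - i), ρ a - ∑ a ∈ range (j₀ - i), ρ a) / (((K - i : ℕ) : ℝ) * Real.sqrt ((K - i : ℕ) : ℝ))) := by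
  have hW : 0 ≤ W := by simpa using hρW 0
  have hsmall : W * γ < b := by nlinarith
  have hx1 : W * γ / b < 1 := (div_lt_one hb).mpr hsmall
  have hx2 : 2 * W * γ / b < 1 := (div_lt_one hb).mpr hsmall2
  have hc : 0 < 1 - W * γ / b := by linarith
  have hc2 : 0 < 1 - 2 * W * γ / b := by linarith
  have hCw : 0 ≤ (1 - W * γ / b) / (1 - 2 * W * γ / b) := div_nonneg hc.le hc2.le
  have h := disc_upper_everywhere hβ hb hγ hρ0 hρW hsmall2 hA hB hAbox hBbox hpin hj₀K
  have hfb := feedback_le_transport hβ hb hγ hρ0 hρW hsmall hA hB hAbox hBbox hpin hj₀K.le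
  have hd0 := disc_zero_le_source hβ hb hγ hρ0 hρW hsmall2 hA hB hAbox hBbox hpin (by omega)
  -- the feedback weight is nonnegative
  have hΦ0 : 0 ≤ 1 / (2 * b * Real.sqrt b) * ∑ i ∈ range j₀,
      (∑ a ∈ range (K - i), ρ a - ∑ a ∈ range (j₀ - i), ρ a) / (((K - i : ℕ) : ℝ) * Real.sqrt ((K - i : ℕ) : ℝ)) := by
    refine mul_nonneg (by positivity) (Finset.sum_nonneg fun i hi => div_nonneg ?_ (by positivity))
    linarith [partialSum_mono hρ0 (show j₀ - i ≤ K - i by omega)]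
  have hd0' : (1 / (gB n) ^ 2 - 1 / (gA 0) ^ 2) / (1 - W * γ / b)
      ≤ (1 - W * γ / b) / (1 - 2 * W * γ / b) / (1 - W * γ / b)
        * (4 * ((b + W * γ) / b) / ((K : ℝ) * Real.sqrt (b * (K : ℝ))) * ∑ a ∈ range (K + n), ρ a * (min (a : ℝ) K) ^ 2) := by
    rw [div_mul_eq_mul_div]
    exact div_le_div_of_nonneg_right hd0 hc.le
  have hchain := hfb.trans (mul_le_mul_of_nonneg_right hd0' hΦ0)
  nlinarith [mul_le_mul_of_nonneg_left hchain hCw]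

/-- THE FEEDBACK WEIGHT UNDER A TAIL MAJORANT: if `τ ≥ 0` with `Σ_{a∈[k,N)} ρ(a) ≤ τ(k)` and `Σ_{k<j₀} τ(k+1) ≤ Ts`, then for `j₀ ≤ K`:
`(1∕(2b√b))·Σ_{i<j₀} (R(K−i) − R(j₀−i))∕((K−i)√(K−i)) ≤ Ts ∕ (2b√b·(K−j₀)√(K−j₀))` — each ultraviolet position `i` acts through ages `≥ j₀ − i`, at
infrared distance `K − i ≥ K − j₀`. [folklore] -/
theorem feedbackWeight_le_tailSum {τ : ℕ → ℝ} {Ts : ℝ} (hb : 0 < b) (hρ0 : ∀ a, 0 ≤ ρ a)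
    (hτ : ∀ k N, k ≤ N → ∑ a ∈ range N, ρ a - ∑ a ∈ range k, ρ a ≤ τ k)
    {j₀ K : ℕ} (hj₀K : j₀ < K) (hTs : ∑ k ∈ range j₀, τ (k + 1) ≤ Ts) :
    1 / (2 * b * Real.sqrt b) * ∑ i ∈ range j₀,
        (∑ a ∈ range (K - i), ρ a - ∑ a ∈ range (j₀ - i), ρ a) / (((K - i : ℕ) : ℝ) * Real.sqrt ((K - i : ℕ) : ℝ))
      ≤ Ts / (2 * b * Real.sqrt b * (((K - j₀ : ℕ) : ℝ) * Real.sqrt ((K - j₀ : ℕ) : ℝ))) := by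
  have hs0 : (0 : ℝ) < ((K - j₀ : ℕ) : ℝ) := by exact_mod_cast (show 0 < K - j₀ by omega)
  have hD : 0 < ((K - j₀ : ℕ) : ℝ) * Real.sqrt ((K - j₀ : ℕ) : ℝ) := by positivity
  have hterm : ∀ i ∈ range j₀, (∑ a ∈ range (K - i), ρ a - ∑ a ∈ range (j₀ - i), ρ a)
        / (((K - i : ℕ) : ℝ) * Real.sqrt ((K - i : ℕ) : ℝ))
      ≤ τ (j₀ - 1 - i + 1) / (((K - j₀ : ℕ) : ℝ) * Real.sqrt ((K - j₀ : ℕ) : ℝ)) := by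
    intro i hi
    have hi' := Finset.mem_range.mp hi
    have hnum : ∑ a ∈ range (K - i), ρ a - ∑ a ∈ range (j₀ - i), ρ a ≤ τ (j₀ - 1 - i + 1) := by
      rw [show j₀ - 1 - i + 1 = j₀ - i by omega]
      exact hτ (j₀ - i) (K - i) (by omega)
    have hnum0 : 0 ≤ ∑ a ∈ range (K - i), ρ a - ∑ a ∈ range (j₀ - i), ρ a := by
      linarith [partialSum_mono hρ0 (show j₀ - i ≤ K - i by omega)]
    have hsi : ((K - j₀ : ℕ) : ℝ) ≤ ((K - i : ℕ) : ℝ) := by exact_mod_cast (show K - j₀ ≤ K - i by omega)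
    have hden : ((K - j₀ : ℕ) : ℝ) * Real.sqrt ((K - j₀ : ℕ) : ℝ) ≤ ((K - i : ℕ) : ℝ) * Real.sqrt ((K - i : ℕ) : ℝ) :=
      mul_le_mul hsi (Real.sqrt_le_sqrt hsi) (Real.sqrt_nonneg _) (by positivity)
    exact div_le_div₀ (hnum0.trans hnum) hnum hD hden
  have hsum : ∑ i ∈ range j₀, (∑ a ∈ range (K - i), ρ a - ∑ a ∈ range (j₀ - i), ρ a)
        / (((K - i : ℕ) : ℝ) * Real.sqrt ((K - i : ℕ) : ℝ))
      ≤ Ts / (((K - j₀ : ℕ) : ℝ) * Real.sqrt ((K - j₀ : ℕ) : ℝ)) := by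
    calc _ ≤ ∑ i ∈ range j₀, τ (j₀ - 1 - i + 1) / (((K - j₀ : ℕ) : ℝ) * Real.sqrt ((K - j₀ : ℕ) : ℝ)) :=
          Finset.sum_le_sum hterm
      _ = (∑ k ∈ range j₀, τ (k + 1)) / (((K - j₀ : ℕ) : ℝ) * Real.sqrt ((K - j₀ : ℕ) : ℝ)) := by
          rw [← Finset.sum_div, Finset.sum_range_reflect (fun k => τ (k + 1)) j₀]
      _ ≤ Ts / (((K - j₀ : ℕ) : ℝ) * Real.sqrt ((K - j₀ : ℕ) : ℝ)) := div_le_div_of_nonneg_right hTs hD.le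
  calc _ ≤ 1 / (2 * b * Real.sqrt b) * (Ts / (((K - j₀ : ℕ) : ℝ) * Real.sqrt ((K - j₀ : ℕ) : ℝ))) :=
        mul_le_mul_of_nonneg_left hsum (by positivity)
    _ = Ts / (2 * b * Real.sqrt b * (((K - j₀ : ℕ) : ℝ) * Real.sqrt ((K - j₀ : ℕ) : ℝ))) := by
        field_simp

/-! ## §2 The supersolution principle -/

/-- **THE SUPERSOLUTION PRINCIPLE** (`2Wγ < b`).  Two pinned runs of the order-0 profile family in ]0,γ] (A: `K` steps, B: `K + n` steps), `κ`, `C_w`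
as above.  IF `M : ℕ → ℝ` satisfies, for every `j₀ < K`, the comparison recursion
`C_w·((4κ∕(K√(b(K−j₀))))·Σ_{a<K+n} ρ(a)min(a,K)(min(a,K)−j₀)₊ + Σ_{i<j₀} (1∕(2b√b))·M(i)·(R(K−i) − R(j₀−i))∕((K−i)√(K−i))) ≤ M(j₀)`,
THEN `d_{j₀} ≤ M(j₀)` for every `j₀ < K` — strong induction from the ultraviolet end on the second file's `disc_upper_everywhere`, the feedback
coefficients `(g^A_i)³∕2·(R(K−i) − R(j₀−i))` being nonnegative and `≤` the profile ones (generation 49's `cube_half_le`).  Generation 51's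
`disc_le_majorant_of_windowLaw` is the instance `M(j) = Λ√(K−j)·τ(j+1)` under (T2). [cite: Balaban1987RG1, (0.20) p.256, (0.31) and Thm 2 p.259] -/
theorem disc_le_supersolution {M : ℕ → ℝ}
    (hβ : ∀ (k : ℕ) (p : Fin (k + 1) → ℝ),
      β k p = b + ∑ i : Fin (k + 1), ρ (k - i) * min (p (Fin.last k)) (|p (Fin.last k) - p i|))
    (hb : 0 < b) (hγ : 0 < γ) (hρ0 : ∀ a, 0 ≤ ρ a) (hρW : ∀ n, ∑ a ∈ range n, ρ a ≤ W) (hsmall2 : 2 * W * γ < b) {K n : ℕ}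
    {gA gB : ℕ → ℝ} (hA : RGEqH K β gA) (hB : RGEqH (K + n) β gB) (hAbox : ∀ k, k ≤ K → 0 < gA k ∧ gA k ≤ γ)
    (hBbox : ∀ k, k ≤ K + n → 0 < gB k ∧ gB k ≤ γ) (hpin : gA K = gB (K + n))
    (hM : ∀ j₀, j₀ < K →
      (1 - W * γ / b) / (1 - 2 * W * γ / b)
          * (4 * ((b + W * γ) / b) / ((K : ℝ) * Real.sqrt (b * ((K - j₀ : ℕ) : ℝ)))
              * ∑ a ∈ range (K + n), ρ a * (min (a : ℝ) K * ((min a K - j₀ : ℕ) : ℝ))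
            + ∑ i ∈ range j₀, 1 / (2 * b * Real.sqrt b) * M i
              * ((∑ a ∈ range (K - i), ρ a - ∑ a ∈ range (j₀ - i), ρ a) / (((K - i : ℕ) : ℝ) * Real.sqrt ((K - i : ℕ) : ℝ))))
        ≤ M j₀) :
    ∀ j₀, j₀ < K → 1 / (gB (j₀ + n)) ^ 2 - 1 / (gA j₀) ^ 2 ≤ M j₀ := by
  have hApos : ∀ k, k ≤ K → 0 < gA k := fun k hk => (hAbox k hk).1
  have hBpos : ∀ k, k ≤ K + n → 0 < gB k := fun k hk => (hBbox k hk).1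
  have hW : 0 ≤ W := by simpa using hρW 0
  have hsmall : W * γ < b := by nlinarith
  have hx1 : W * γ / b < 1 := (div_lt_one hb).mpr hsmall
  have hx2 : 2 * W * γ / b < 1 := (div_lt_one hb).mpr hsmall2
  have hCw : 0 ≤ (1 - W * γ / b) / (1 - 2 * W * γ / b) := div_nonneg (by linarith) (by linarith)
  have hlo : BetaLowerH b γ β :=
    RemainderExplicitHistoryHalfMomentWitness.lower (γ := γ) (lam := fun k i => ρ (k - i)) hβ (fun k i => hρ0 _)
  have hdom := invSq_le_invSq_shift_run hβ hb hρ0 hA hB hApos hBpos hpin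
  intro j₀
  induction j₀ using Nat.strong_induction_on with
  | _ j₀ ih =>
    intro hj₀K
    have h := disc_upper_everywhere hβ hb hγ hρ0 hρW hsmall2 hA hB hAbox hBbox hpin hj₀K
    have hfb : (∑ i ∈ range j₀, (gA i) ^ 3 / 2 * (1 / (gB (i + n)) ^ 2 - 1 / (gA i) ^ 2)
          * (∑ a ∈ range (K - i), ρ a - ∑ a ∈ range (j₀ - i), ρ a))
        ≤ ∑ i ∈ range j₀, 1 / (2 * b * Real.sqrt b) * M i
          * ((∑ a ∈ range (K - i), ρ a - ∑ a ∈ range (j₀ - i), ρ a) / (((K - i : ℕ) : ℝ) * Real.sqrt ((K - i : ℕ) : ℝ))) := by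
      refine Finset.sum_le_sum fun i hi => ?_
      have hi' := Finset.mem_range.mp hi
      have hiK : i < K := hi'.trans hj₀K
      have hd0 : 0 ≤ 1 / (gB (i + n)) ^ 2 - 1 / (gA i) ^ 2 := by linarith [hdom i hiK.le]
      have hdM : 1 / (gB (i + n)) ^ 2 - 1 / (gA i) ^ 2 ≤ M i := ih i hi' hiK
      have hw0 : 0 ≤ ∑ a ∈ range (K - i), ρ a - ∑ a ∈ range (j₀ - i), ρ a := by
        linarith [partialSum_mono hρ0 (show j₀ - i ≤ K - i by omega)]
      have hcube := cube_half_le hγ hb hA hAbox hlo hiK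
      have hs0 : (0 : ℝ) < ((K - i : ℕ) : ℝ) := by exact_mod_cast (show 0 < K - i by omega)
      calc (gA i) ^ 3 / 2 * (1 / (gB (i + n)) ^ 2 - 1 / (gA i) ^ 2) * (∑ a ∈ range (K - i), ρ a - ∑ a ∈ range (j₀ - i), ρ a)
          ≤ (1 / (2 * b * Real.sqrt b) * (1 / (((K - i : ℕ) : ℝ) * Real.sqrt ((K - i : ℕ) : ℝ)))) * M i
              * (∑ a ∈ range (K - i), ρ a - ∑ a ∈ range (j₀ - i), ρ a) :=
            mul_le_mul_of_nonneg_right (mul_le_mul hcube hdM hd0 (by positivity)) hw0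
        _ = 1 / (2 * b * Real.sqrt b) * M i
              * ((∑ a ∈ range (K - i), ρ a - ∑ a ∈ range (j₀ - i), ρ a) / (((K - i : ℕ) : ℝ) * Real.sqrt ((K - i : ℕ) : ℝ))) := by
            field_simp
    exact h.trans (le_trans (mul_le_mul_of_nonneg_left (add_le_add le_rfl hfb) hCw) (hM j₀ hj₀K))

/-! ## §3 A pinned family: the upper law with the transported term, every infrared distance and every cutoff -/

/-- **ROAD P3 — THE RATE IN THE CUTOFF, UPPER SIDE AT EVERY `(m, n)`, UNCONDITIONAL** (`2Wγ < b`).  A family `K ↦ g K` of runs of the order-0 profile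
family in ]0,γ] pinned at one `g_IR` (`b > 0`, `γ > 0`, `ρ ≥ 0`, `Σ_{a<N} ρ_a ≤ W`, `2Wγ < b`); `κ = (b+Wγ)∕b`, `C_w = (1−Wγ∕b)∕(1−2Wγ∕b)`.  IF `Ψ` bounds the
partial sums `Σ_{a<N} ρ(a)·min(a,n+m)·(min(a,n+m) − n)₊` and `Ψ₀` the partial sums `Σ_{a<N} ρ(a)·min(a,n+m)²` (all `N`), THEN for `m ≥ 1`:
`astar g m − invSq g m n ≤ C_w·(4κ∕((n+m)√(bm)))·Ψ + C_w·(C_w∕(1−Wγ∕b))·(4κ∕((n+m)√(b(n+m))))·Ψ₀·(1∕(2b√b))·Σ_{i<n} (R(n+m−i) − R(n−i))∕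
((n+m−i)√(n+m−i))`
(`disc_upper_transport` on the pairs (run `n+m`, run `n+m+n′`) at the position `n`, then `n′ → ∞` by generation 47's `continuum_monotone`).
[cite: Balaban1987RG1, (0.20) p.256, (0.31) and Thm 2 p.259] -/
theorem astar_sub_invSq_upper_transport {Ψ Ψ₀ : ℝ}
    (hβ : ∀ (k : ℕ) (p : Fin (k + 1) → ℝ),
      β k p = b + ∑ i : Fin (k + 1), ρ (k - i) * min (p (Fin.last k)) (|p (Fin.last k) - p i|))
    (hb : 0 < b) (hγ : 0 < γ) (hρ0 : ∀ a, 0 ≤ ρ a) (hρW : ∀ n, ∑ a ∈ range n, ρ a ≤ W) (hsmall2 : 2 * W * γ < b)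
    {g : ℕ → ℕ → ℝ} {gIR : ℝ} (hrun : ∀ K, RGEqH K β (g K)) (hbox : ∀ K i, i ≤ K → 0 < g K i ∧ g K i ≤ γ)
    (hpin : ∀ K, g K K = gIR) {m : ℕ} (hm : 1 ≤ m) (n : ℕ)
    (hΨ : ∀ N, ∑ a ∈ range N, ρ a * (min (a : ℝ) ((n + m : ℕ) : ℝ) * ((min a (n + m) - n : ℕ) : ℝ)) ≤ Ψ)
    (hΨ₀ : ∀ N, ∑ a ∈ range N, ρ a * (min (a : ℝ) ((n + m : ℕ) : ℝ)) ^ 2 ≤ Ψ₀) :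
    astar g m - invSq g m n
      ≤ (1 - W * γ / b) / (1 - 2 * W * γ / b)
          * (4 * ((b + W * γ) / b) / (((n + m : ℕ) : ℝ) * Real.sqrt (b * (m : ℝ))) * Ψ)
        + (1 - W * γ / b) / (1 - 2 * W * γ / b) * ((1 - W * γ / b) / (1 - 2 * W * γ / b) / (1 - W * γ / b))
          * (4 * ((b + W * γ) / b) / (((n + m : ℕ) : ℝ) * Real.sqrt (b * ((n + m : ℕ) : ℝ))) * Ψ₀)
          * (1 / (2 * b * Real.sqrt b) * ∑ i ∈ range n,
              (∑ a ∈ range (n + m - i), ρ a - ∑ a ∈ range (n - i), ρ a)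
                / (((n + m - i : ℕ) : ℝ) * Real.sqrt ((n + m - i : ℕ) : ℝ))) := by
  have hW : 0 ≤ W := by simpa using hρW 0
  have hsmall : W * γ < b := by nlinarith
  have hx1 : W * γ / b < 1 := (div_lt_one hb).mpr hsmall
  have hx2 : 2 * W * γ / b < 1 := (div_lt_one hb).mpr hsmall2
  have hc : 0 < 1 - W * γ / b := by linarith
  have hc2 : 0 < 1 - 2 * W * γ / b := by linarith
  have hCw : 0 ≤ (1 - W * γ / b) / (1 - 2 * W * γ / b) := div_nonneg hc.le hc2.le
  have hmpos : (0 : ℝ) < m := by exact_mod_cast hm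
  have hKpos : (0 : ℝ) < ((n + m : ℕ) : ℝ) := by exact_mod_cast (show 0 < n + m by omega)
  have hκ0 : 0 ≤ (b + W * γ) / b := by positivity
  -- the feedback weight is nonnegative
  have hΦ0 : 0 ≤ 1 / (2 * b * Real.sqrt b) * ∑ i ∈ range n,
      (∑ a ∈ range (n + m - i), ρ a - ∑ a ∈ range (n - i), ρ a)
        / (((n + m - i : ℕ) : ℝ) * Real.sqrt ((n + m - i : ℕ) : ℝ)) := by
    refine mul_nonneg (by positivity) (Finset.sum_nonneg fun i hi => div_nonneg ?_ (by positivity))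
    linarith [partialSum_mono hρ0 (show n - i ≤ n + m - i by omega)]
  have ht := (continuum_monotone hβ hb hγ hρ0 hρW hrun hbox hpin).1 m
  have hshift : Tendsto (fun n' : ℕ => n + n') atTop atTop :=
    (tendsto_add_atTop_nat n).congr (fun n' => Nat.add_comm n' n)
  have ht' : Tendsto (fun n' => invSq g m (n + n') - invSq g m n) atTop (𝓝 (astar g m - invSq g m n)) :=
    (ht.comp hshift).sub_const _
  refine le_of_tendsto' ht' (fun n' => ?_)
  -- the bound for the longer run `n + m + n′`
  have hA : RGEqH (n + m) β (g (n + m)) := hrun (n + m)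
  have hB : RGEqH (n + m + n') β (g (n + m + n')) := hrun (n + m + n')
  have hpin' : g (n + m) (n + m) = g (n + m + n') (n + m + n') := by rw [hpin, hpin]
  have h := disc_upper_transport hβ hb hγ hρ0 hρW hsmall2 hA hB (hbox (n + m)) (hbox (n + m + n')) hpin'
    (j₀ := n) (by omega)
  rw [show n + m - n = m by omega] at h
  have e1 : 1 / (g (n + m + n') (n + n')) ^ 2 = invSq g m (n + n') := by
    rw [invSq_def, show n + n' + m = n + m + n' by omega]
  have e2 : 1 / (g (n + m) n) ^ 2 = invSq g m n := by rw [invSq_def]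
  rw [e1, e2] at h
  refine h.trans (add_le_add ?_ ?_)
  · exact mul_le_mul_of_nonneg_left (mul_le_mul_of_nonneg_left (hΨ _) (by positivity)) hCw
  · refine mul_le_mul_of_nonneg_right (mul_le_mul_of_nonneg_left ?_ (by positivity)) hΦ0
    exact mul_le_mul_of_nonneg_left (hΨ₀ _) (by positivity)

end Summit.QuantumFields.BalabanUV.Beta.RemainderExplicitHistoryDiagonalTransport

end
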